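import Summits.QuantumFields.YangMills.Theorems.UnitScaleTiltFluctuationComparisonRegPrLiftLegsCoeff

/-!
# Route `UnitScaleTilt` — crux K1bR-pr `FluctuationComparisonRegPr(L)` (stmt-QuantumFields-19201 → 19935), stub `stub_oneStepSmallLift`, piece (L2)
# for INTERIOR-SUPPORTED kernels — the Γ-LEG LAYER, file 9: TRANSVERSE NEUTRALITY IMPLIES LINE-NEUTRALITY (the hypothesis p2 g10's tensor table
# `kzT` («ANSATZ T») delivers; support file `--supports stmt-QuantumFields-19935`)

Cell `ym3-torus` (HUMAN RULING D-0037, YM ladder rung R3), seat `ym3-torus-p1` gen 11 (UV side; cell memo HOME/UV3-NODE.md §20).  ym3-torus-p2 g10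
(STATUS 01:49:04Z) types p2 g9's tensor-homotopy lift as a symbolic tree-coordinate table `kzT P` (R = 1, interior-supported, every odd L ≥ 5) and
certifies STRONG TRANSVERSE NEUTRALITY: for every direction `a`, orientation `o`, displacement `k` and EVERY `a`-offset `q`, the sum of
`kz a r o k` over the offsets `r` with `r_a = q` vanishes (every term of `Z′` carries the 1-D homotopy `h` in a transverse slot, `Σ h = 0`).  Here:

* `TransverseNeutral R kz := ∀ a o k q, Σ_r kz a (r[a ↦ q]) o k = 0` (the fleet's `SNeutral` is the case `q = L − 1`);
* `sum_inOff_eq_zero` / `sum_outOff_eq_zero`: a function `G` of the offsets whose `a`-transverse sums `Σ_r G(r[a ↦ q])` vanish for every `q` has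
  vanishing in-row and out-row double sums `Σ_r Σ_{t<L−r_a} G(r[a ↦ r_a+t])`, `Σ_r Σ_{t<r_a} G(r[a ↦ t])` (split `r ↦ (r_a, r_⊥)` by `Equiv.funSplitAt`);
* **`lineNeutral_of_transverseNeutral : TransverseNeutral R kz → LineNeutral R kz`** (through `lineNeutral_of_lineCoeff`).

So `exists_approxSmallLift_of_kernel_lineNeutral` (file 6) applies to `kzT` with `TransverseNeutral ∧ RowMass ∧ RowBound λ_T β_T`,
`λ_T = (3L−1)²(2L−1)/(L³(L+1)²) < L^{-1/2}` — the per-`L` clause of `stub_oneStepSmallLift` for every odd `L ≥ 5`.  Elementary; nothing of Bałaban's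
is asserted.
-/

noncomputable section

open scoped BigOperators

namespace Summit.QuantumFields.YangMills.Theorems.ApproxLift

open Literature.MathematicalPhysics.QuantumFieldTheory.Balaban1983to89
open T4Continuum BlockAveraging AveragingRT B10Eq47AxialChi BlockAveragingSection BlockAveragingSectionPlaq

variable {P : Params} {j : ℕ} {n : Type*}
variable {R : ℕ} {kz : Fin P.d → (Fin P.d → Fin P.L) → Orient P.d → (Fin P.d → Fin (2 * R + 1)) → ℝ}

/-! ## §1 Transverse neutrality -/

/-- **TRANSVERSE NEUTRALITY** of a kernel table: for every direction `a`, orientation `o`, displacement `k` and every `a`-offset `q`, the sum of the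
entries over all offsets with `a`-component `q` vanishes (each transverse offset counted `L` times, as in the fleet's `SNeutral`, which is `q = L−1`). -/
def TransverseNeutral (R : ℕ) (kz : Fin P.d → (Fin P.d → Fin P.L) → Orient P.d → (Fin P.d → Fin (2 * R + 1)) → ℝ) : Prop :=
  ∀ (a : Fin P.d) (o : Orient P.d) (k : Fin P.d → Fin (2 * R + 1)) (q : Fin P.L),
    ∑ r : Fin P.d → Fin P.L, kz a (Function.update r a q) o k = 0

/-- Transverse neutrality contains S-neutrality. -/
theorem sNeutral_of_transverseNeutral (hT : TransverseNeutral R kz) : SNeutral R kz := fun a o k => hT a o k (lastPos P)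

/-! ## §2 Splitting the offsets `r ↦ (r_a, r_⊥)` -/

section Split

variable (a : Fin P.d)

/-- `update r a q` in the split coordinates: `(q, r_⊥)`. -/
theorem funSplitAt_update (r : Fin P.d → Fin P.L) (q : Fin P.L) :
    Equiv.funSplitAt a (Fin P.L) (Function.update r a q) = (q, (Equiv.funSplitAt a (Fin P.L) r).2) := by
  refine Prod.ext ?_ (funext fun i => ?_)
  · simp [Function.update_self]
  · simp [Function.update_of_ne i.property]

/-- `update r a q = split⁻¹ (q, r_⊥)`. -/
theorem update_eq_funSplitAt_symm (r : Fin P.d → Fin P.L) (q : Fin P.L) :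
    Function.update r a q = (Equiv.funSplitAt a (Fin P.L)).symm (q, (Equiv.funSplitAt a (Fin P.L) r).2) := by
  rw [← funSplitAt_update, Equiv.symm_apply_apply]

/-- The in-row index `v + t` (`t < L − v`). -/
def inIdx (v : Fin P.L) (t : Fin (P.L - (v : ℕ))) : Fin P.L := ⟨(v : ℕ) + (t : ℕ), by have := t.isLt; omega⟩

/-- The out-row index `t` (`t < v`). -/
def outIdx (v : Fin P.L) (t : Fin (v : ℕ)) : Fin P.L := ⟨(t : ℕ), by have := t.isLt; have := v.isLt; omega⟩

/-- `inOff r a t = r[a ↦ inIdx (r a) t]` (definitional). -/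
theorem inOff_eq (r : Fin P.d → Fin P.L) (t : Fin (P.L - (r a : ℕ))) : inOff r a t = Function.update r a (inIdx (r a) t) := rfl

/-- `outOff r a t = r[a ↦ outIdx (r a) t]` (definitional). -/
theorem outOff_eq (r : Fin P.d → Fin P.L) (t : Fin (r a : ℕ)) : outOff r a t = Function.update r a (outIdx (r a) t) := rfl

variable {a}

/-- Transverse sums in split coordinates: if `Σ_r G(r[a ↦ q]) = 0` then `Σ_{r⊥} G(split⁻¹(q, r⊥)) = 0`. -/
theorem sum_transverse_eq_zero (G : (Fin P.d → Fin P.L) → ℝ)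
    (hG : ∀ q : Fin P.L, ∑ r : Fin P.d → Fin P.L, G (Function.update r a q) = 0) (q : Fin P.L) :
    ∑ y : {i // i ≠ a} → Fin P.L, G ((Equiv.funSplitAt a (Fin P.L)).symm (q, y)) = 0 := by
  have h1 : ∑ r : Fin P.d → Fin P.L, G (Function.update r a q) =
      ∑ p : Fin P.L × ({i // i ≠ a} → Fin P.L), G ((Equiv.funSplitAt a (Fin P.L)).symm (q, p.2)) :=
    Fintype.sum_equiv (Equiv.funSplitAt a (Fin P.L)) _ _ fun r => by rw [update_eq_funSplitAt_symm]
  have h := hG q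
  rw [h1, Fintype.sum_prod_type] at h
  simp only [Finset.sum_const, Finset.card_univ, Fintype.card_fin, nsmul_eq_mul] at h
  have hL : (P.L : ℝ) ≠ 0 := by exact_mod_cast P.L_pos.ne'
  exact (mul_eq_zero.mp h).resolve_left hL

/-- **IN-ROW DOUBLE SUMS VANISH**: `Σ_r Σ_{t<L−r_a} G(r[a ↦ r_a + t]) = 0` whenever all `a`-transverse sums of `G` vanish. -/
theorem sum_inOff_eq_zero (G : (Fin P.d → Fin P.L) → ℝ)
    (hG : ∀ q : Fin P.L, ∑ r : Fin P.d → Fin P.L, G (Function.update r a q) = 0) :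
    ∑ r : Fin P.d → Fin P.L, ∑ t : Fin (P.L - (r a : ℕ)), G (inOff r a t) = 0 := by
  rw [Fintype.sum_equiv (Equiv.funSplitAt a (Fin P.L)) (fun r => ∑ t : Fin (P.L - (r a : ℕ)), G (inOff r a t))
    (fun p => ∑ t : Fin (P.L - (p.1 : ℕ)), G ((Equiv.funSplitAt a (Fin P.L)).symm (inIdx p.1 t, p.2))) fun r =>
      Finset.sum_congr rfl fun t _ => by rw [inOff_eq, update_eq_funSplitAt_symm]; rfl]
  rw [Fintype.sum_prod_type]
  refine Finset.sum_eq_zero fun v _ => ?_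
  show ∑ y : {i // i ≠ a} → Fin P.L, ∑ t : Fin (P.L - (v : ℕ)), G ((Equiv.funSplitAt a (Fin P.L)).symm (inIdx v t, y)) = 0
  rw [Finset.sum_comm]
  exact Finset.sum_eq_zero fun t _ => sum_transverse_eq_zero G hG _

/-- **OUT-ROW DOUBLE SUMS VANISH**: `Σ_r Σ_{t<r_a} G(r[a ↦ t]) = 0` whenever all `a`-transverse sums of `G` vanish. -/
theorem sum_outOff_eq_zero (G : (Fin P.d → Fin P.L) → ℝ)
    (hG : ∀ q : Fin P.L, ∑ r : Fin P.d → Fin P.L, G (Function.update r a q) = 0) :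
    ∑ r : Fin P.d → Fin P.L, ∑ t : Fin (r a : ℕ), G (outOff r a t) = 0 := by
  rw [Fintype.sum_equiv (Equiv.funSplitAt a (Fin P.L)) (fun r => ∑ t : Fin (r a : ℕ), G (outOff r a t))
    (fun p => ∑ t : Fin (p.1 : ℕ), G ((Equiv.funSplitAt a (Fin P.L)).symm (outIdx p.1 t, p.2))) fun r =>
      Finset.sum_congr rfl fun t _ => by rw [outOff_eq, update_eq_funSplitAt_symm]; rfl]
  rw [Fintype.sum_prod_type]
  refine Finset.sum_eq_zero fun v _ => ?_
  show ∑ y : {i // i ≠ a} → Fin P.L, ∑ t : Fin (v : ℕ), G ((Equiv.funSplitAt a (Fin P.L)).symm (outIdx v t, y)) = 0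
  rw [Finset.sum_comm]
  exact Finset.sum_eq_zero fun t _ => sum_transverse_eq_zero G hG _

end Split

/-! ## §3 Transverse neutrality implies line-neutrality -/

/-- Every line coefficient of a transversely neutral table vanishes. -/
theorem lineCoeff_eq_zero_of_transverseNeutral (hT : TransverseNeutral R kz) (a : Fin P.d) (o : Orient P.d) (m : Fin P.d → ℤ) :
    lineCoeff R kz a o m = 0 := by
  unfold lineCoeff
  have hin := sum_inOff_eq_zero (a := a)
    (fun p => ∑ k : Fin P.d → Fin (2 * R + 1), if kvec R k = m then kz a p o k else 0) fun q => by
      rw [Finset.sum_comm]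
      refine Finset.sum_eq_zero fun k _ => ?_
      by_cases hk : kvec R k = m
      · simp_rw [if_pos hk]; exact hT a o k q
      · simp_rw [if_neg hk]; exact Finset.sum_const_zero
  have hout := sum_outOff_eq_zero (a := a)
    (fun p => ∑ k : Fin P.d → Fin (2 * R + 1), if bvec true a + kvec R k = m then kz a p o k else 0) fun q => by
      rw [Finset.sum_comm]
      refine Finset.sum_eq_zero fun k _ => ?_
      by_cases hk : bvec true a + kvec R k = m
      · simp_rw [if_pos hk]; exact hT a o k q
      · simp_rw [if_neg hk]; exact Finset.sum_const_zero
  rw [hin, hout, add_zero]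

/-- **TRANSVERSE NEUTRALITY IMPLIES LINE-NEUTRALITY.** -/
theorem lineNeutral_of_transverseNeutral (hT : TransverseNeutral R kz) : LineNeutral (n := n) R kz :=
  lineNeutral_of_lineCoeff fun a o m _ => lineCoeff_eq_zero_of_transverseNeutral hT a o m

end Summit.QuantumFields.YangMills.Theorems.ApproxLift

end
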